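import Literature.AnabelianGeometry.EtaleTheta.Discharge.Sec5TransportsOfBiKummerData
import Literature.AnabelianGeometry.EtaleTheta.Discharge.Sec5StrvTransportOfBiKummerData
import Literature.AlgebraicGeometry.Frobenioids.CoAngular

/-!
# [EtTh] Thm. 5.10 (ii) at the assembled §5 data: ONE unit `e` for the transports of `s^⊓_N`, `s^⊔_N` AND `s^trv_N` (pp. 334–335 / PDF pp. 108–109)

Mochizuki, *The étale theta function …*, Publ. RIMS **45** (2009), proof of Thm. 5.10 (ii), p.334–335 (PDF pp.108–109): "`Ψ` preserves
`(s^⊓_N, s^⊔_N)` … [cf. Theorem 5.7] … as well as the corresponding bi-Kummer `N`-th roots [cf. Theorem 4.4, (iv)]" — print uses ONE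
identification `Ψ(A_N) ⥲ A_N` for both [cite: MochizukiEtTh2009, Thm 5.10 (ii) p.334 (PDF p.108)]; Prop. 5.3 (vi) p.326 (PDF p.100)
(the divisors of `s^⊓_N`, `s^⊔_N` are preserved).

PROOF-ONLY (no definitions, no new named facts).  abc-iut cell, layer L2, row #2-R18 / RULINGS #6 (R52) (prover abc-iut-w5-d245),
closing the residual sentence of GAP row G-w5d245-1: the binders `hT`, `hT′`, `hu`, `hstrv` of
`ThetaFrobenioid.cyclotomicRigidityPreserved_ofBiKummerData` (p421202) share ONE `e ∈ Aut_C(A_N)`.  `Sec5TransportsOfBiKummerData`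
(p424854) produces `hT ∧ hT′ ∧ hu` for any `e` matching the divisors of the transported sections (Prop. 5.3 (vi) at `A_N`), and
`Sec5StrvTransportOfBiKummerData` produces `hstrv` for a UNIT `e ∈ O^×(A_N)` ([FrdI] Prop. 5.6).  Since pre-composition with a unit
does not change zero divisors (`Div(e ≫ s) = Base(e)^*Div(s) · Div(e)^{deg s} = Div(s)`: units are base-identity and, [FrdI] Rem.
1.1.1, isomorphisms are isometries — `PreFrobenioid.isIsometry_of_isIso`), the divisor matching for that unit `e` IS Prop. 5.3 (vi) in
its printed form "`Div(α⁻¹ ≫ Ψ(s^⊓_N) ≫ β) = Div(s^⊓_N)`" (`e = 1`).  Hence `exists_unit_transports_ofBiKummerData`: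
`∃ e ∈ O^×(A_N), ∃ D_c D_p, hT[β ≫ D_c⁻¹] ∧ hT′[β ≫ D_c⁻¹, D_p] ∧ D_p ∈ O^×(B_N) ∧ StrvTransport Ψ α e θ_B` — the four binders with the
SAME `e`, from the model hypotheses, the section pair of `s^trv_N`, the base shadow / Frobenius transport of `Ψ` at `A_N`, and Prop. 5.3
(vi) at `A_N`.  Nothing asserts that the §5 data exist for an actual curve; no side is taken on [IUTchIII] Cor. 3.12.
-/

noncomputable section

open CategoryTheory

namespace Literature.AlgebraicGeometry.Frobenioids

namespace PreFrobenioid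

universe w v v' u u'

variable {D : Type u} [Category.{v} D] {Φ : Dᵒᵖ ⥤ CommMonCat.{w}}
  {C : Type u'} [Category.{v'} C] (F : C ⥤ ElemFrobenioid Φ)

/-- **Pre-composition with a unit does not change the zero divisor** ([FrdI] Rem. 1.1.1:
`Div(e ∘? s)`… precisely `Div(s ∘ e) = Base(e)^* Div(s) + deg_Fr(s)·Div(e)` with `Base(e) = id` and `Div(e) = 0` for
`e ∈ O^×(A)`, isomorphisms being isometries over a divisorial `Φ`). [cite: MochizukiFrdI2008, Rem. 1.1.1 p.20] -/
theorem div_unit_hom_comp (hP : IsPreFrobenioid Φ F) {A B : C} (s : A ⟶ B) {e : Aut A} (he : e ∈ unitsSubgroup F A) :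
    Div F (e.hom ≫ s) = Div F s := by
  rw [div_comp, show Base F e.hom = 𝟙 _ from he.1, show Div F e.hom = 1 from isIsometry_of_isIso F hP e.hom, one_pow,
    mul_one]
  exact Frobenioids.pull_id Φ _ _

end PreFrobenioid

end Literature.AlgebraicGeometry.Frobenioids

namespace Literature.AnabelianGeometry.EtaleTheta

open Literature.AlgebraicGeometry.Frobenioids

namespace ThetaFrobenioid

universe u₀ v₀ u v w

variable {K : Type u₀} [Field K]
  {X : SemiGraphs.TemperedArithmeticGroup.{u₀} K} {D₀ : Type u₀} [Category.{v₀} D₀]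
  {V : FrdIMonoidStub.{w}} {T₀ : RealifiedDivisorMonoids (D₀ := D₀) V} {D : Type u} [Category.{v} D]
  {VD : FrdICatStub.{u, v, w} D} {S : BiKummerSetting X T₀ D VD}
  {pullFrac : ∀ {A A' : S.C} (_ : A' ⟶ A), S.biratUnits A → S.biratUnits A'}
  {lv N : ℕ+} {T : ThetaEnvData.{max v w} N} {θr : S.biratUnits S.Aodot} {Bl : S.C}
  {Pl : S.FractionPair θr Bl} {Rl : S.NthRoot θr Pl lv pullFrac}
  (h : ModelFrobenioid.Hypotheses S.tf.divisorMonoid S.tf.ratFnFunctor)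
  (toB : ∀ A : S.C, S.biratUnits A →* S.tf.biratUnitsModel A) (Q : FrobenioidTheta.ThetaSubquotientStub.{w} D)
  (odd_l : Odd (lv : ℕ)) (R : S.NthRoot Rl.root Rl.pair N pullFrac) (ιX : T.PiX ≃ₜ* X.Pi)
  (hopen : IsOpen ((S.galoisSurj R.AN.base R.αData.isGalois).ker : Set X.Pi)) (σ : Aut R.AN.base →* Aut R.AN)
  (K' : Type w) [Field K'] (constEmb : K'ˣ →* S.tf.biratUnitsModel R.BN)
  (constEmb_injective : Function.Injective constEmb)
  (hdivc : ∀ g : Aut R.BN.base,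
    ModelFrobenioid.div ((σ ((BiKummerSetting.NthRoot.baseIso S R).conjAut.symm g)).hom ≫ R.pair.num) =
      ModelFrobenioid.div R.pair.num)
  (hdivp : ∀ y : T.PiYdd,
    ModelFrobenioid.div ((σ (S.galoisSurj R.AN.base R.αData.isGalois (ιX y.1))).hom ≫ R.pair.den) =
      ModelFrobenioid.div R.pair.den)

/-- For the model tempered Frobenioid of the §4 setting, pre-composing with a unit of `A` does not change zero divisors
(`PreFrobenioid.div_unit_hom_comp` read through `ofBiKummerData_pre = rfl`). [cite: MochizukiFrdI2008, Rem. 1.1.1 p.20] -/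
theorem div_unit_hom_comp_ofBiKummerData {A B : S.C} (s : A ⟶ B) {e : Aut A}
    (he : e ∈ (ofBiKummerData h toB Q odd_l R ιX hopen σ K' constEmb constEmb_injective hdivc hdivp).units A) :
    (ofBiKummerData h toB Q odd_l R ιX hopen σ K' constEmb constEmb_injective hdivc hdivp).pre.div (e.hom ≫ s) =
      (ofBiKummerData h toB Q odd_l R ιX hopen σ K' constEmb constEmb_injective hdivc hdivp).pre.div s :=
  PreFrobenioid.div_unit_hom_comp S.F
    (ModelFrobenioid.isFrobenioid (DivB := S.tf.divBNatTrans) h.isMonoidOn h.isDivisorial h.isMonoidOn_rat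
      h.isGroupLike_rat h.isGraphConnected h.isTotallyEpimorphic).isPreFrobenioid s he

/-- **Thm. 5.10 (ii), first two sentences, at the assembled §5 data with ONE `e`**: for a self-equivalence `Ψ` of the model
tempered Frobenioid (base of FSM-type, "`Ψ` preserves base-equivalent pairs"), identifications `α, β`, the base shadow `θ` of `Ψ`
at `A_N` through `α` with the Frobenius-transport clauses ([FrdI] Thm. 3.4 (iii)), `s^trv_N = σ` extending to a section pair
`(σ, φ)` ("arising from a base-Frobenius pair of `A_N`"), and Prop. 5.3 (vi) at `A_N` in its printed form
(`Div(α⁻¹ ≫ Ψ(s^⊓_N) ≫ β) = Div(s^⊓_N)`, same for `s^⊔_N`): there are ONE UNIT `e ∈ O^×(A_N)` and `D_c, D_p` with `hT`, `hT′` (for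
`β ≫ D_c⁻¹`), `D_p ∈ O^×(B_N)` AND `StrvTransport Ψ α e θ_B` — the binders `hT`, `hT′`, `hu`, `hstrv` of
`cyclotomicRigidityPreserved_ofBiKummerData` with the same `e`. [cite: MochizukiEtTh2009, Thm 5.10 (ii) p.334 (PDF p.108)] -/
theorem exists_unit_transports_ofBiKummerData (hD : IsOfFSMType D)
    (Ψ : S.C ≌ S.C)
    (hbe : ∀ ⦃A A' : S.C⦄ (φ ψ : A ⟶ A'),
      (ofBiKummerData h toB Q odd_l R ιX hopen σ K' constEmb constEmb_injective hdivc hdivp).pre.BaseEquivalent φ ψ →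
      (ofBiKummerData h toB Q odd_l R ιX hopen σ K' constEmb constEmb_injective hdivc hdivp).pre.BaseEquivalent
        (Ψ.functor.map φ) (Ψ.functor.map ψ))
    (hσ : ∀ g : Aut R.AN.base, ModelFrobenioid.baseMap (σ g).hom = g.hom)
    (φ : ℕ+ →* End R.AN)
    (hφ : ∀ n : ℕ+, PreFrobenioid.degFr S.F (End.asHom (φ n)) = n ∧
      PreFrobenioid.IsBaseIdentity S.F (End.asHom (φ n)) ∧ PreFrobenioid.IsFrobeniusType S.F (End.asHom (φ n)))
    (hc : ∀ (n : ℕ+) (g : Aut R.AN.base), (σ g).hom ≫ End.asHom (φ n) = End.asHom (φ n) ≫ (σ g).hom)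
    (α : Ψ.functor.obj (ofBiKummerData h toB Q odd_l R ιX hopen σ K' constEmb constEmb_injective hdivc hdivp).AN ≅
      (ofBiKummerData h toB Q odd_l R ιX hopen σ K' constEmb constEmb_injective hdivc hdivp).AN)
    (β : Ψ.functor.obj (ofBiKummerData h toB Q odd_l R ιX hopen σ K' constEmb constEmb_injective hdivc hdivp).BN ≅
      (ofBiKummerData h toB Q odd_l R ιX hopen σ K' constEmb constEmb_injective hdivc hdivp).BN)
    (θ : Aut R.AN.base ≃* Aut R.AN.base)
    (hθ : ∀ f : Aut R.AN, (PreFrobenioid.baseFunctor S.F).mapIso (α.symm ≪≫ Ψ.functor.mapIso f ≪≫ α) =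
      θ ((PreFrobenioid.baseFunctor S.F).mapIso f))
    (ΨN : ℕ+ ≃* ℕ+)
    (hdeg : ∀ f : R.AN ⟶ R.AN, PreFrobenioid.degFr S.F (α.inv ≫ Ψ.functor.map f ≫ α.hom) = ΨN (PreFrobenioid.degFr S.F f))
    (hbi : ∀ f : R.AN ⟶ R.AN, PreFrobenioid.IsBaseIdentity S.F f →
      PreFrobenioid.IsBaseIdentity S.F (α.inv ≫ Ψ.functor.map f ≫ α.hom))
    (hft : ∀ f : R.AN ⟶ R.AN, PreFrobenioid.IsFrobeniusType S.F f →
      PreFrobenioid.IsFrobeniusType S.F (α.inv ≫ Ψ.functor.map f ≫ α.hom))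
    (hdivcap₁ : (ofBiKummerData h toB Q odd_l R ιX hopen σ K' constEmb constEmb_injective hdivc hdivp).pre.div
        (α.inv ≫ Ψ.functor.map (ofBiKummerData h toB Q odd_l R ιX hopen σ K' constEmb constEmb_injective hdivc hdivp).sCap ≫
          β.hom) =
      (ofBiKummerData h toB Q odd_l R ιX hopen σ K' constEmb constEmb_injective hdivc hdivp).pre.div
        (ofBiKummerData h toB Q odd_l R ιX hopen σ K' constEmb constEmb_injective hdivc hdivp).sCap)
    (hdivcup₁ : (ofBiKummerData h toB Q odd_l R ιX hopen σ K' constEmb constEmb_injective hdivc hdivp).pre.div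
        (α.inv ≫ Ψ.functor.map (ofBiKummerData h toB Q odd_l R ιX hopen σ K' constEmb constEmb_injective hdivc hdivp).sCup ≫
          β.hom) =
      (ofBiKummerData h toB Q odd_l R ιX hopen σ K' constEmb constEmb_injective hdivc hdivp).pre.div
        (ofBiKummerData h toB Q odd_l R ιX hopen σ K' constEmb constEmb_injective hdivc hdivp).sCup) :
    ∃ e ∈ (ofBiKummerData h toB Q odd_l R ιX hopen σ K' constEmb constEmb_injective hdivc hdivp).units
        (ofBiKummerData h toB Q odd_l R ιX hopen σ K' constEmb constEmb_injective hdivc hdivp).AN,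
      ∃ Dc Dp : Aut (ofBiKummerData h toB Q odd_l R ιX hopen σ K' constEmb constEmb_injective hdivc hdivp).BN,
        α.inv ≫ Ψ.functor.map (ofBiKummerData h toB Q odd_l R ιX hopen σ K' constEmb constEmb_injective hdivc hdivp).sCap ≫
            (β ≪≫ Dc.symm).hom =
          e.hom ≫ (ofBiKummerData h toB Q odd_l R ιX hopen σ K' constEmb constEmb_injective hdivc hdivp).sCap ≫
            (1 : Aut (ofBiKummerData h toB Q odd_l R ιX hopen σ K' constEmb constEmb_injective hdivc hdivp).BN).hom ∧
        α.inv ≫ Ψ.functor.map (ofBiKummerData h toB Q odd_l R ιX hopen σ K' constEmb constEmb_injective hdivc hdivp).sCup ≫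
            (β ≪≫ Dc.symm).hom =
          e.hom ≫ (ofBiKummerData h toB Q odd_l R ιX hopen σ K' constEmb constEmb_injective hdivc hdivp).sCup ≫ Dp.hom ∧
        Dp ∈ (ofBiKummerData h toB Q odd_l R ιX hopen σ K' constEmb constEmb_injective hdivc hdivp).units
          (ofBiKummerData h toB Q odd_l R ιX hopen σ K' constEmb constEmb_injective hdivc hdivp).BN ∧
        (ofBiKummerData h toB Q odd_l R ιX hopen σ K' constEmb constEmb_injective hdivc hdivp).StrvTransport Ψ α e
          (((ofBiKummerData h toB Q odd_l R ιX hopen σ K' constEmb constEmb_injective hdivc hdivp).autBaseIsoAB.symm.trans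
            θ).trans (ofBiKummerData h toB Q odd_l R ιX hopen σ K' constEmb constEmb_injective hdivc hdivp).autBaseIsoAB) := by
  -- the unit of [FrdI] Prop. 5.6 / Thm. 4.4 (iv)
  obtain ⟨e, he, hstrv⟩ :=
    exists_unit_strvTransport_ofBiKummerData h toB Q odd_l R ιX hopen σ K' constEmb constEmb_injective hdivc hdivp hσ φ hφ hc
      Ψ α θ hθ ΨN hdeg hbi hft
  -- Prop. 5.3 (vi) for `e = 1` is Prop. 5.3 (vi) for the unit `e`
  have hdivcap := hdivcap₁.trans
    (div_unit_hom_comp_ofBiKummerData h toB Q odd_l R ιX hopen σ K' constEmb constEmb_injective hdivc hdivp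
      (ofBiKummerData h toB Q odd_l R ιX hopen σ K' constEmb constEmb_injective hdivc hdivp).sCap he).symm
  have hdivcup := hdivcup₁.trans
    (div_unit_hom_comp_ofBiKummerData h toB Q odd_l R ιX hopen σ K' constEmb constEmb_injective hdivc hdivp
      (ofBiKummerData h toB Q odd_l R ιX hopen σ K' constEmb constEmb_injective hdivc hdivp).sCup he).symm
  obtain ⟨Dc, Dp, hT, hT', hu⟩ :=
    exists_capCupTransport_ofBiKummerData h toB Q odd_l R ιX hopen σ K' constEmb constEmb_injective hdivc hdivp hD Ψ hbe α β e
      hdivcap hdivcup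
  exact ⟨e, he, Dc, Dp, hT, hT', hu, hstrv⟩

end ThetaFrobenioid

end Literature.AnabelianGeometry.EtaleTheta

end
-- olean re-land 2026-08-26 (abc-iut-w5-d034 for abc-iut-w5-d245, abc-iut-L2-lead ruling 07:52:32Z): byte-identical declarations, comment only.
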